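import Literature.Barriers.CriticalPhenomena.TimarMassTransport
import HarnessLib

/-!
# Timár 2006, proof of Thm. 5.5 (last paragraph): Lemma 5.1 along an exhaustion by
# finite-component subforests bounds the expected degree of the exhausted graph — PROVED
# (abstract form)

Barrier catalogue `Literature/Barriers/CriticalPhenomena/`; a brick of the programme proving
Timár's Thm. 5.5 (`Timar2006_finiteLevelUnion`, `TimarCriticalNonunimodular.lean`), in the
abstract invariant-space setting of `TimarMassTransport.lean` (a measure `μ` on `Ω` preserved by
measurable maps `act γ`, `γ ∈ Aut(G)`; Lemma 5.1 = `lintegral_encard_neighborSet_le`). Á. Timár,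
*Percolation on nonunimodular transitive graphs*, Ann. Probab. 34 (2006) 2344–2364, end of the
proof of Thm. 5.5 (p. 2360 of the journal, p. 17 of arXiv:math/0702875):

> "The forest `Φ` that we have obtained is an equivariant function of the 1-partition, the
> percolation and the (independent) extra random variables that we were using. Every vertex has
> expected degree `> 2μ` on that it is in `Φ`. On the other hand, it has an equivariant
> exhaustion `R_i` by graphs of only finite components … Each resulting `R_i` has only finite
> connected components and any edge in these graphs has both endpoints in the same class of the
> 1-partition. So, Lemma 5.1 tells us that the expected degree in the graph `R_i` is `< 2μ`. On
> the other hand, the sequence `(R_i)_i` exhausts `Φ` because … the endpoints of any edge of `Φ`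
> are in the same component of `R_i` with probability tending to 1. This contradicts the fact
> that the expected degree in `Φ` is `> 2μ`."

## What is proved (the analytic content of this passage, for ANY random graph `Φ`)

Let `Φ : Ω → BondConfig V` be measurable (no invariance, no acyclicity and no finiteness is asked
of `Φ` itself), `D` a vertex set containing every vertex with a `Φ`-neighbour, measurable in `ξ`,
and `R_i : Ω → BondConfig V` (`i : ℕ`) measurable, equivariant, with `R_i ⊆ Φ`, almost surely
acyclic with finite clusters ("graphs of only finite components" inside the forest `Φ`), and with
the weight bound `w(y) ≤ B w(x)` on the `R_i`-cluster of `x` (both endpoints of every edge in one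
class of the 1-partition, `B = μ`). If `(R_i)` **exhausts `Φ` at `x`** in the printed sense —
for every `y`, `P(x ∼_Φ y and not x ∼_{R_i} y) → 0` — then

* `lintegral_encard_neighborSet_le_liminf` — `E[deg_Φ x] ≤ liminf_i E[deg_{R_i} x]`
  (`E[deg] = Σ_y P(x ∼ y)`, `lintegral_encard_neighborSet_eq_tsum`; per `y` the probabilities
  converge, `tendsto_measure_adj_of_exhaustion`; Fatou's lemma for the sum over `y`);
* `lintegral_encard_neighborSet_le_of_exhaustion` — **`E[deg_Φ x] ≤ 2B · P(x ∈ D)`**: Lemma 5.1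
  (`lintegral_encard_neighborSet_le`) bounds every `E[deg_{R_i} x]` by `2B · P(x ∈ D)`;
* `not_exhaustion_of_lt_lintegral_encard_neighborSet` — the printed contradiction: if
  `E[deg_Φ x] > 2B · P(x ∈ D)` ("expected degree `> 2μ` on that it is in `Φ`"), no such
  exhaustion exists;
* `tendsto_measure_prod_snd_mem_bad`, `tendsto_measure_mem_bad_of_indepFun` — how the printed
  proof obtains the exhaustion hypothesis from Prop. 5.4: if the bad event for the edge `{x, y}`
  is "`S` is split by `P_i`" for a random element `S` of a COUNTABLE set (the finite set of levels
  met by an open path joining `x` to `y`) and randomness `P_i` INDEPENDENT of `S` splitting every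
  fixed `S` with probability `→ 0`, then the bad event has probability `→ 0` (Fubini and dominated
  convergence; product form and `IndepFun` form).

The measures are assumed finite (probability spaces in the application); for the Lemma 5.1 part
`G` is connected, locally finite and transitive (the hypotheses of Lemma 2.2 / Lemma 5.1 in the
tree).

## References

* Á. Timár, Ann. Probab. 34 (2006) 2344–2364 (arXiv:math/0702875), §5: proof of Thm. 5.5, last
  paragraph; Lemma 5.1; Prop. 5.4. [Timar2006]
* R. Lyons, Y. Peres, *Probability on Trees and Networks*, CUP 2016, §8.2 (the tilted
  mass-transport principle, (8.10)). [LyonsPeres2016]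
-/

noncomputable section

namespace Literature.Barriers.CriticalPhenomena

open _root_.MeasureTheory _root_.Filter Literature.Probability.Percolation SimpleGraph
open scoped ENNReal Topology

variable {V : Type*} {Ω : Type*} [MeasurableSpace Ω]

/-! ### Expected degree as a sum of adjacency probabilities -/

/-- The event "`x ∼ y` in the random graph `Φ`" is measurable for a measurably varying
configuration. [folklore] -/
theorem measurableSet_openGraph_adj_comp {Φ : Ω → BondConfig V} (hΦ : Measurable Φ) (x y : V) :
    MeasurableSet {ξ | (openGraph (Φ ξ)).Adj x y} := by
  simp_rw [openGraph_adj]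
  exact ((measurable_set_mem _).comp hΦ).setOf.inter (MeasurableSet.const _)

/-- The degree of `x` (as `encard` of the open neighbourhood, in `[0, ∞]`) is the sum over `y` of
the indicators of `x ∼ y`. [folklore] -/
theorem encard_neighborSet_eq_tsum_indicator (H : BondConfig V) (x : V) :
    (((openGraph H).neighborSet x).encard : ℝ≥0∞) =
      ∑' y, ({y | (openGraph H).Adj x y} : Set V).indicator (fun _ => (1 : ℝ≥0∞)) y := by
  rw [tsum_indicator_const, mul_one]
  rfl

/-- **`E[deg_Φ x] = Σ_y P(x ∼_Φ y)`** for a measurable random graph on countably many vertices.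
[folklore] -/
theorem lintegral_encard_neighborSet_eq_tsum [Countable V] (μ : Measure Ω) {Φ : Ω → BondConfig V}
    (hΦ : Measurable Φ) (x : V) :
    ∫⁻ ξ, (((openGraph (Φ ξ)).neighborSet x).encard : ℝ≥0∞) ∂μ =
      ∑' y, μ {ξ | (openGraph (Φ ξ)).Adj x y} := by
  have h : ∀ ξ, (((openGraph (Φ ξ)).neighborSet x).encard : ℝ≥0∞) =
      ∑' y, ({ξ | (openGraph (Φ ξ)).Adj x y} : Set Ω).indicator (fun _ => (1 : ℝ≥0∞)) ξ := by
    intro ξ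
    rw [encard_neighborSet_eq_tsum_indicator]
    refine tsum_congr fun y => ?_
    by_cases hxy : (openGraph (Φ ξ)).Adj x y
    · rw [Set.indicator_of_mem (show y ∈ {y | (openGraph (Φ ξ)).Adj x y} from hxy),
        Set.indicator_of_mem (show ξ ∈ {ξ | (openGraph (Φ ξ)).Adj x y} from hxy)]
    · rw [Set.indicator_of_notMem (show y ∉ {y | (openGraph (Φ ξ)).Adj x y} from hxy),
        Set.indicator_of_notMem (show ξ ∉ {ξ | (openGraph (Φ ξ)).Adj x y} from hxy)]
  simp_rw [h]
  rw [lintegral_tsum fun y => (measurable_const.indicator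
    (measurableSet_openGraph_adj_comp hΦ x y)).aemeasurable]
  refine tsum_congr fun y => ?_
  rw [lintegral_indicator_const (measurableSet_openGraph_adj_comp hΦ x y), one_mul]

/-! ### Exhaustion: per-edge convergence and Fatou -/

/-- **Per-edge convergence under exhaustion**: if `R_i ⊆ Φ` and
`P(x ∼_Φ y, ¬ x ∼_{R_i} y) → 0`, then `P(x ∼_{R_i} y) → P(x ∼_Φ y)` (finite measure).
[cite: Timar2006, Thm. 5.5 (proof: "the endpoints of any edge of Φ are in the same component of R_i with probability tending to 1")] -/
theorem tendsto_measure_adj_of_exhaustion (μ : Measure Ω) [IsFiniteMeasure μ]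
    {Φ : Ω → BondConfig V} {R : ℕ → Ω → BondConfig V}
    (hRΦ : ∀ i ξ, R i ξ ⊆ Φ ξ) {x y : V}
    (hexh : Tendsto (fun i => μ {ξ | (openGraph (Φ ξ)).Adj x y ∧ ¬ (openGraph (R i ξ)).Adj x y})
      atTop (𝓝 0)) :
    Tendsto (fun i => μ {ξ | (openGraph (R i ξ)).Adj x y}) atTop
      (𝓝 (μ {ξ | (openGraph (Φ ξ)).Adj x y})) := by
  set c := μ {ξ | (openGraph (Φ ξ)).Adj x y} with hc
  have hcT : c ≠ ⊤ := measure_ne_top μ _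
  -- upper bound: `R_i ⊆ Φ`
  have hup : ∀ i, μ {ξ | (openGraph (R i ξ)).Adj x y} ≤ c := by
    intro i
    refine measure_mono fun ξ hξ => ?_
    exact openGraph_mono (hRΦ i ξ) hξ
  -- lower bound: `c ≤ P(x ∼_{R_i} y) + P(x ∼_Φ y, ¬ x ∼_{R_i} y)`
  have hlow : ∀ i, c ≤ μ {ξ | (openGraph (R i ξ)).Adj x y} +
      μ {ξ | (openGraph (Φ ξ)).Adj x y ∧ ¬ (openGraph (R i ξ)).Adj x y} := by
    intro i
    calc c ≤ μ ({ξ | (openGraph (R i ξ)).Adj x y} ∪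
          {ξ | (openGraph (Φ ξ)).Adj x y ∧ ¬ (openGraph (R i ξ)).Adj x y}) := by
            refine measure_mono fun ξ hξ => ?_
            by_cases h : (openGraph (R i ξ)).Adj x y
            · exact Or.inl h
            · exact Or.inr ⟨hξ, h⟩
      _ ≤ _ := measure_union_le _ _
  have hsub : Tendsto (fun i => c - μ {ξ | (openGraph (Φ ξ)).Adj x y ∧ ¬ (openGraph (R i ξ)).Adj x y})
      atTop (𝓝 c) := by
    have h := ENNReal.Tendsto.sub (tendsto_const_nhds (x := c)) hexh (Or.inl hcT)
    rwa [tsub_zero] at h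
  refine tendsto_of_tendsto_of_tendsto_of_le_of_le hsub tendsto_const_nhds (fun i => ?_) hup
  exact tsub_le_iff_right.2 (hlow i)

/-- **Fatou along an exhaustion: `E[deg_Φ x] ≤ liminf_i E[deg_{R_i} x]`.** With
`E[deg] = Σ_y P(x ∼ y)` and the per-edge convergence, this is Fatou's lemma for the sum over `y`.
[cite: Timar2006, Thm. 5.5 (proof: "the sequence (R_i)_i exhausts Φ")] -/
theorem lintegral_encard_neighborSet_le_liminf [Countable V] (μ : Measure Ω) [IsFiniteMeasure μ]
    {Φ : Ω → BondConfig V} (hΦm : Measurable Φ) {R : ℕ → Ω → BondConfig V}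
    (hRm : ∀ i, Measurable (R i)) (hRΦ : ∀ i ξ, R i ξ ⊆ Φ ξ) {x : V}
    (hexh : ∀ y, Tendsto
      (fun i => μ {ξ | (openGraph (Φ ξ)).Adj x y ∧ ¬ (openGraph (R i ξ)).Adj x y}) atTop (𝓝 0)) :
    ∫⁻ ξ, (((openGraph (Φ ξ)).neighborSet x).encard : ℝ≥0∞) ∂μ ≤
      liminf (fun i => ∫⁻ ξ, (((openGraph (R i ξ)).neighborSet x).encard : ℝ≥0∞) ∂μ) atTop := by
  rw [lintegral_encard_neighborSet_eq_tsum μ hΦm x]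
  simp_rw [lintegral_encard_neighborSet_eq_tsum μ (hRm _) x]
  -- per `y`: `P(x ∼_Φ y) = liminf_i P(x ∼_{R_i} y)`
  have hlim : ∀ y, μ {ξ | (openGraph (Φ ξ)).Adj x y} =
      liminf (fun i => μ {ξ | (openGraph (R i ξ)).Adj x y}) atTop := fun y =>
    (tendsto_measure_adj_of_exhaustion μ hRΦ (hexh y)).liminf_eq.symm
  simp_rw [hlim]
  -- Fatou for the counting measure on `V`
  letI : MeasurableSpace V := ⊤
  haveI : MeasurableSingletonClass V := ⟨fun _ => MeasurableSpace.measurableSet_top⟩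
  have h := lintegral_liminf_le' (μ := (Measure.count : Measure V)) (u := (atTop : Filter ℕ))
    (f := fun i y => μ {ξ | (openGraph (R i ξ)).Adj x y})
    (fun i => (measurable_from_top (f := fun y => μ {ξ | (openGraph (R i ξ)).Adj x y})).aemeasurable)
  simpa only [lintegral_count] using h

/-! ### Exhaustion in probability from an independent exhaustion of a countable index set

"The sequence `(R_i)_i` exhausts `Φ` because any set of finitely many levels of `G` is contained
in the same class of `P_i` with probability tending to 1 and hence the endpoints of any edge of
`Φ` are in the same component of `R_i` with probability tending to 1" (proof of Thm. 5.5): the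
bad event for the edge `{x, y}` is contained in "the finite set `S` of levels read off from the
rest of the randomness is split by `P_i`", where `P_i` is INDEPENDENT of `S` and splits each FIXED
finite set with probability `→ 0` (Prop. 5.4). Conditioning on `S` (a random element of a
countable set) and dominated convergence give probability `→ 0`. -/

section Independent

variable {Ω₁ Ω₂ T : Type*} [MeasurableSpace Ω₁] [MeasurableSpace Ω₂] [MeasurableSpace T]
  [MeasurableSingletonClass T] [Countable T]

omit [MeasurableSpace Ω₁] in
/-- The event "the second coordinate is bad for the index read off from the first" is a countable
union of measurable rectangles. [folklore] -/
theorem measurableSet_snd_mem_bad [MeasurableSpace Ω₁] {S : Ω₁ → T} (hS : Measurable S)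
    {Bad : T → Set Ω₂} (hBm : ∀ t, MeasurableSet (Bad t)) :
    MeasurableSet {p : Ω₁ × Ω₂ | p.2 ∈ Bad (S p.1)} := by
  have h : {p : Ω₁ × Ω₂ | p.2 ∈ Bad (S p.1)} = ⋃ t, (S ⁻¹' {t}) ×ˢ Bad t := by
    ext p
    simp only [Set.mem_setOf_eq, Set.mem_iUnion, Set.mem_prod, Set.mem_preimage,
      Set.mem_singleton_iff]
    exact ⟨fun hp => ⟨S p.1, rfl, hp⟩, fun ⟨t, ht, hp⟩ => ht ▸ hp⟩
  rw [h]
  exact MeasurableSet.iUnion fun t => (hS (measurableSet_singleton t)).prod (hBm t)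

/-- **Conditioning on independent randomness (product form).** On `Ω₁ × Ω₂` with a product of
finite measures, let `S : Ω₁ → T` (countable `T`) be measurable and `Bad_i t ⊆ Ω₂` measurable with
`μ₂(Bad_i t) → 0` for every FIXED `t`. Then `(μ₁ ⊗ μ₂){(ξ₁, ξ₂) : ξ₂ ∈ Bad_i (S ξ₁)} → 0`
(Fubini: the measure is `∫ μ₂(Bad_i (S ξ₁)) dμ₁`; dominated convergence with the bound `μ₂(Ω₂)`).
[cite: Timar2006, Thm. 5.5 (proof: "any set of finitely many levels of G is contained in the same class of P_i with probability tending to 1 and hence …")] -/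
theorem tendsto_measure_prod_snd_mem_bad (μ₁ : Measure Ω₁) [IsFiniteMeasure μ₁]
    (μ₂ : Measure Ω₂) [IsFiniteMeasure μ₂] {S : Ω₁ → T} (hS : Measurable S)
    {Bad : ℕ → T → Set Ω₂} (hBm : ∀ i t, MeasurableSet (Bad i t))
    (hBad : ∀ t, Tendsto (fun i => μ₂ (Bad i t)) atTop (𝓝 0)) :
    Tendsto (fun i => (μ₁.prod μ₂) {p : Ω₁ × Ω₂ | p.2 ∈ Bad i (S p.1)}) atTop (𝓝 0) := by
  have happ : ∀ i, (μ₁.prod μ₂) {p : Ω₁ × Ω₂ | p.2 ∈ Bad i (S p.1)} =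
      ∫⁻ ξ₁, μ₂ (Bad i (S ξ₁)) ∂μ₁ := by
    intro i
    rw [Measure.prod_apply (measurableSet_snd_mem_bad hS (hBm i))]
    rfl
  simp_rw [happ]
  have hmeas : ∀ i, Measurable fun ξ₁ => μ₂ (Bad i (S ξ₁)) := fun i =>
    (measurable_of_countable fun t => μ₂ (Bad i t)).comp hS
  have h := tendsto_lintegral_of_dominated_convergence (μ := μ₁) (fun _ => μ₂ Set.univ) hmeas
    (fun i => Eventually.of_forall fun ξ₁ => measure_mono (Set.subset_univ _))
    (by rw [lintegral_const]; exact ENNReal.mul_ne_top (measure_ne_top _ _) (measure_ne_top _ _))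
    (Eventually.of_forall fun ξ₁ => hBad (S ξ₁))
  simpa only [lintegral_zero] using h

end Independent

/-- **Conditioning on independent randomness (one probability space).** If `S : Ω → T` (countable
`T`) and `η : Ω → Ω₂` are independent under the finite measure `μ`, `Bad_i t ⊆ Ω₂` is measurable
and `μ(η ∈ Bad_i t) → 0` for every fixed `t`, then `μ(η ∈ Bad_i (S)) → 0`. In the proof of
Thm. 5.5: `η` = the randomness of the exhaustion `(P_i)` of Prop. 5.4, `S` = the finite set of
levels met by an open path joining the endpoints of an edge of `Φ` (a function of the percolation,
the 1-partition and the labels, of which `(P_i)` is independent), `Bad_i t` = "`t` is not inside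
one class of `P_i`".
[cite: Timar2006, Thm. 5.5 (proof: "the endpoints of any edge of Φ are in the same component of R_i with probability tending to 1") and Prop. 5.4] -/
theorem tendsto_measure_mem_bad_of_indepFun {Ω Ω₂ T : Type*} [MeasurableSpace Ω]
    [MeasurableSpace Ω₂] [MeasurableSpace T] [MeasurableSingletonClass T] [Countable T]
    (μ : Measure Ω) [IsFiniteMeasure μ] {S : Ω → T} (hS : Measurable S) {η : Ω → Ω₂}
    (hη : Measurable η) (hind : ProbabilityTheory.IndepFun S η μ)
    {Bad : ℕ → T → Set Ω₂} (hBm : ∀ i t, MeasurableSet (Bad i t))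
    (hBad : ∀ t, Tendsto (fun i => μ {ξ | η ξ ∈ Bad i t}) atTop (𝓝 0)) :
    Tendsto (fun i => μ {ξ | η ξ ∈ Bad i (S ξ)}) atTop (𝓝 0) := by
  have hprod := (ProbabilityTheory.indepFun_iff_map_prod_eq_prod_map_map hS.aemeasurable
    hη.aemeasurable).1 hind
  haveI : IsFiniteMeasure (μ.map S) := Measure.isFiniteMeasure_map μ S
  haveI : IsFiniteMeasure (μ.map η) := Measure.isFiniteMeasure_map μ η
  have happ : ∀ i, μ {ξ | η ξ ∈ Bad i (S ξ)} =
      ((μ.map S).prod (μ.map η)) {p : T × Ω₂ | p.2 ∈ Bad i (id p.1)} := by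
    intro i
    rw [← hprod, Measure.map_apply (hS.prodMk hη) (measurableSet_snd_mem_bad measurable_id (hBm i))]
    rfl
  simp_rw [happ]
  have hBad' : ∀ t, Tendsto (fun i => (μ.map η) (Bad i t)) atTop (𝓝 0) := by
    intro t
    simp_rw [Measure.map_apply hη (hBm _ t)]
    exact hBad t
  exact tendsto_measure_prod_snd_mem_bad (μ.map S) (μ.map η) measurable_id hBm hBad'

/-! ### Lemma 5.1 along an exhaustion -/

section Invariant

variable {G : SimpleGraph V} [G.LocallyFinite]

/-- **Timár 2006, end of the proof of Thm. 5.5, PROVED (abstract form): Lemma 5.1 along an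
exhaustion.** On an invariant space `(Ω, μ, act)` over a connected, locally finite, transitive
graph `G` (weights `w = autWeight G o`), let `Φ : Ω → BondConfig V` be ANY measurable random
graph, `D ⊇ {vertices with a Φ-neighbour}` measurable, and `R_i ⊆ Φ` measurable equivariant random
graphs, each almost surely acyclic with finite clusters and with `w(y) ≤ B w(x)` on the
`R_i`-cluster of `x`. If `(R_i)` exhausts `Φ` at `x` (`P(x ∼_Φ y, ¬ x ∼_{R_i} y) → 0` for every
`y`), then `E[deg_Φ x] ≤ 2B · P(x ∈ D)`: by Lemma 5.1 each `E[deg_{R_i} x] ≤ 2B · P(x ∈ D)`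
("Lemma 5.1 tells us that the expected degree in the graph `R_i` is `< 2μ`"), and
`E[deg_Φ x] ≤ liminf_i E[deg_{R_i} x]` (`lintegral_encard_neighborSet_le_liminf`).
[cite: Timar2006, Thm. 5.5 (proof, last paragraph) and Lemma 5.1] -/
theorem lintegral_encard_neighborSet_le_of_exhaustion (hconn : G.Connected)
    (ht : IsGraphTransitive G) (μ : Measure Ω) [IsFiniteMeasure μ] (act : (G ≃g G) → Ω → Ω)
    (hact : ∀ γ, Measurable (act γ)) (hμ : ∀ γ, μ.map (act γ) = μ)
    {Φ : Ω → BondConfig V} (hΦm : Measurable Φ)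
    {D : Ω → Set V} (hDm : ∀ x, MeasurableSet {ξ | x ∈ D ξ})
    (hΦD : ∀ ξ x y, (openGraph (Φ ξ)).Adj x y → x ∈ D ξ)
    {R : ℕ → Ω → BondConfig V} (hRm : ∀ i, Measurable (R i))
    (hRinv : ∀ i γ ξ, R i (act γ ξ) = BondConfig.relabel (sym2Equiv γ.toEquiv) (R i ξ))
    (hRΦ : ∀ i ξ, R i ξ ⊆ Φ ξ)
    (htree : ∀ i, ∀ᵐ ξ ∂μ, (openGraph (R i ξ)).IsAcyclic ∧ ∀ x, (openCluster (R i ξ) x).Finite)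
    (o : V) {B : ℝ≥0∞} (hBT : B ≠ ⊤)
    (hB : ∀ i, ∀ᵐ ξ ∂μ, ∀ x y, y ∈ openCluster (R i ξ) x → autWeight G o y ≤ B * autWeight G o x)
    {x : V} (hexh : ∀ y, Tendsto
      (fun i => μ {ξ | (openGraph (Φ ξ)).Adj x y ∧ ¬ (openGraph (R i ξ)).Adj x y}) atTop (𝓝 0)) :
    ∫⁻ ξ, (((openGraph (Φ ξ)).neighborSet x).encard : ℝ≥0∞) ∂μ ≤ 2 * B * μ {ξ | x ∈ D ξ} := by
  haveI : Countable V := countable_of_connected_of_locallyFinite G hconn o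
  -- Lemma 5.1 for each `R_i`, with the vertex set `D` of `Φ`
  have h51 : ∀ i, ∫⁻ ξ, (((openGraph (R i ξ)).neighborSet x).encard : ℝ≥0∞) ∂μ ≤
      2 * B * μ {ξ | x ∈ D ξ} := fun i =>
    lintegral_encard_neighborSet_le hconn ht μ act hact hμ (hRm i) (hRinv i) hDm
      (fun ξ a b hab => hΦD ξ a b (openGraph_mono (hRΦ i ξ) hab)) (htree i) o hBT (hB i) x
  refine (lintegral_encard_neighborSet_le_liminf μ hΦm hRm hRΦ hexh).trans ?_
  exact liminf_le_of_frequently_le' (Frequently.of_forall h51)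

/-- **The printed contradiction.** If moreover "every vertex has expected degree `> 2μ` on that it
is in `Φ`" — `E[deg_Φ x] > 2B · P(x ∈ D)` — then `Φ` admits no exhaustion by equivariant
subgraphs with finite tree components obeying the weight bound: "This contradicts the fact that
the expected degree in `Φ` is `> 2μ`." [cite: Timar2006, Thm. 5.5 (proof, last sentence)] -/
theorem not_exhaustion_of_lt_lintegral_encard_neighborSet (hconn : G.Connected)
    (ht : IsGraphTransitive G) (μ : Measure Ω) [IsFiniteMeasure μ] (act : (G ≃g G) → Ω → Ω)
    (hact : ∀ γ, Measurable (act γ)) (hμ : ∀ γ, μ.map (act γ) = μ)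
    {Φ : Ω → BondConfig V} (hΦm : Measurable Φ)
    {D : Ω → Set V} (hDm : ∀ x, MeasurableSet {ξ | x ∈ D ξ})
    (hΦD : ∀ ξ x y, (openGraph (Φ ξ)).Adj x y → x ∈ D ξ)
    {R : ℕ → Ω → BondConfig V} (hRm : ∀ i, Measurable (R i))
    (hRinv : ∀ i γ ξ, R i (act γ ξ) = BondConfig.relabel (sym2Equiv γ.toEquiv) (R i ξ))
    (hRΦ : ∀ i ξ, R i ξ ⊆ Φ ξ)
    (htree : ∀ i, ∀ᵐ ξ ∂μ, (openGraph (R i ξ)).IsAcyclic ∧ ∀ x, (openCluster (R i ξ) x).Finite)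
    (o : V) {B : ℝ≥0∞} (hBT : B ≠ ⊤)
    (hB : ∀ i, ∀ᵐ ξ ∂μ, ∀ x y, y ∈ openCluster (R i ξ) x → autWeight G o y ≤ B * autWeight G o x)
    {x : V} (hdeg : 2 * B * μ {ξ | x ∈ D ξ} <
      ∫⁻ ξ, (((openGraph (Φ ξ)).neighborSet x).encard : ℝ≥0∞) ∂μ) :
    ¬ ∀ y, Tendsto
      (fun i => μ {ξ | (openGraph (Φ ξ)).Adj x y ∧ ¬ (openGraph (R i ξ)).Adj x y}) atTop (𝓝 0) :=
  fun hexh => absurd (lintegral_encard_neighborSet_le_of_exhaustion hconn ht μ act hact hμ hΦm hDm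
    hΦD hRm hRinv hRΦ htree o hBT hB hexh) (not_le.2 hdeg)

end Invariant

end Literature.Barriers.CriticalPhenomena

end
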